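import Summits.KontsevichZagierPeriods.KontsevichZagierPeriods.Theorems.SoloInformedToricCornerMove
import Summits.KontsevichZagierPeriods.KontsevichZagierPeriods.Theorems.SoloInformedCubeWord
import HarnessLib

/-!
# THEOREM MZV: the cube crux for the cube representations of multiple zeta values

Solo programme `solo-KontsevichZagierPeriods-informed`, session s104 (closure properties, 5).

The cube representation `CubeW u = [(0,1)^{m+1}, F_ε]` of an admissible multiple zeta value
(`soloInformedCubeW`, `⟦CubeW u⟧ = mzvClass u` by `soloInformed_cubeW_class`) has denominator
`(∏_{εᵢ} (1 − x₀⋯xᵢ)) · (1 − x₀⋯x_m)`; its reflection under the corner move is a product of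
arbitrary-subset zeta denominators, hence cube-nondegenerate
(`soloInformed_cubeNondegenerate_reflect_cubeWDen`).  Consequently

* **THEOREM MZV** `soloInformed_presentable_cubeW`: `of (CubeW u) ∈ soloInformedPresentable` for
  every admissible index `u` — the cube crux `SoloInformedAyoubCubeResolutionCube` holds for the
  cube representation of every multiple zeta value, inside the KZ calculus (`k = 1`,
  `soloInformed_cubeResolution_cubeW`);
* `soloInformed_mzvClass_eq_germ_combination`: every `mzvClass u` is the class of a presentable
  formal representation, i.e. of a `ℤ`-combination (modulo `KZ.relations`) of cube integrals of
  real parts of germs holomorphic near closed cubes.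

References: M. Kontsevich, D. Zagier, *Periods* (2001) §1.2; J. Ayoub, EMS Newsl. 91 (2014)
§2.2; D. Zagier, *Values of zeta functions and their applications* (1994) §9.
-/

noncomputable section

open scoped BigOperators
open MeasureTheory Set
open Literature.NumberTheory.Transcendental Literature.NumberTheory.Transcendental.KZ
open Literature.ModelTheory.ExponentialFields (IsSemialgebraic)

namespace Summit.KontsevichZagierPeriods.KontsevichZagierPeriods.Theorems

/-! ## Reflected multiple-zeta denominators -/

/-- The reflected prefix denominators `reflect (1 − x₀⋯xⱼ) = 1 − ∏_{i≤j} (1 − xᵢ)` are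
cube-nondegenerate. [this work] -/
theorem soloInformed_cubeNondegenerate_reflect_prefix {m : ℕ} (j : Fin m) :
    SoloInformedCubeNondegenerate (soloInformedReflect m (1 - soloInformedMonoPoly m j)) := by
  have h := soloInformed_cubeNondegenerate_subsetZeta
    (Finset.univ.filter fun i : Fin m => i ≤ j) ⟨j, by simp⟩
  convert h using 1
  unfold soloInformedMonoPoly soloInformedPrefixProd
  rw [map_sub, map_one, map_prod]
  simp only [soloInformed_reflect_X]

/-- The reflected denominator of every cube word `F_ε` is cube-nondegenerate. [this work] -/
theorem soloInformed_cubeNondegenerate_reflect_cubeWDen {m : ℕ} (ε : Fin (m + 1) → Bool) :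
    SoloInformedCubeNondegenerate (soloInformedReflect (m + 1) (soloInformedCubeWDen ε)) := by
  rw [soloInformedCubeWDen, map_mul, map_prod]
  refine soloInformed_cubeNondegenerate_mul
    (soloInformed_cubeNondegenerate_prod Finset.univ _ fun i _ => ?_)
    (soloInformed_cubeNondegenerate_reflect_prefix _)
  split_ifs
  · exact soloInformed_cubeNondegenerate_reflect_prefix _
  · rw [map_one]
    exact soloInformed_cubeNondegenerate_one

/-- **THEOREM MZV (the cube crux for multiple zeta values).**  For every admissible index `u`, the
cube representation `CubeW u = [(0,1)^{m+1}, F_ε]` of `ζ(u)` is presentable: `of (CubeW u)` is, modulo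
`KZ.relations`, a `ℤ`-combination of cube integrals of real parts of germs holomorphic near the
closed cube (`k = 1`). [this work] -/
theorem soloInformed_presentable_cubeW {m : ℕ} (u : List ℕ) (hu : MZV.IsAdmissible u)
    (hw : MZV.weight u = m + 1) :
    of (soloInformedCubeW u hu hw) ∈ soloInformedPresentable :=
  soloInformed_presentable_of_reflect_nondegenerate_open
    (soloInformedCubeWNum (soloInformedWordFn u m)) (soloInformedCubeWDen (soloInformedWordFn u m))
    (soloInformed_cubeNondegenerate_reflect_cubeWDen _) (soloInformedCubeW u hu hw) rfl
    fun x _ => by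
      simp only [soloInformedCubeW_integrand, soloInformed_aeval_cubeWNum,
        soloInformed_aeval_cubeWDen, soloInformed_cubeWf_eq_div]

/-- **THEOREM MZV in the output format of the cube crux** `SoloInformedAyoubCubeResolutionCube`:
the cube representation of every multiple zeta value admits an Ayoub cube resolution inside the
KZ calculus. [this work] -/
theorem soloInformed_cubeResolution_cubeW {m : ℕ} (u : List ℕ) (hu : MZV.IsAdmissible u)
    (hw : MZV.weight u = m + 1) :
    ∃ (k : ℕ) (_ : k ≠ 0) (m' : ℕ) (d : Fin m' → ℕ) (G : ∀ j, SoloInformedCubeGerm (d j))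
      (c : Fin m' → ℤ) (ρ : ∀ j, IntegralRep (d j)),
      (∀ j, (ρ j).domain = soloInformedCube (d j)) ∧
      (∀ j, EqOn (ρ j).integrand (fun x => ((G j).g (soloInformedToC (d j) x)).re)
        (soloInformedCube (d j))) ∧
      k • of (soloInformedCubeW u hu hw) - ∑ j, c j • of (ρ j) ∈ relations :=
  soloInformed_exists_fin_of_presentable (soloInformed_presentable_cubeW u hu hw)

/-- **Every multiple zeta class is presentable**: for every admissible index `u` there is a
presentable formal representation whose class in the formal period ring is `mzvClass u`.
[this work] -/
theorem soloInformed_mzvClass_eq_germ_combination {m : ℕ} (u : List ℕ) (hu : MZV.IsAdmissible u)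
    (hw : MZV.weight u = m + 1) :
    ∃ x ∈ soloInformedPresentable, toFormalPeriod x = mzvClass u :=
  ⟨of (soloInformedCubeW u hu hw), soloInformed_presentable_cubeW u hu hw,
    soloInformed_cubeW_class u hu hw⟩

end Summit.KontsevichZagierPeriods.KontsevichZagierPeriods.Theorems
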